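import Literature.NumberTheory.LFunctions.SchoenfeldExplicit
import Literature.NumberTheory.LFunctions.SchoenfeldPsiTable
import Literature.NumberTheory.LFunctions.SchoenfeldPsiMid
import Literature.NumberTheory.LFunctions.SchoenfeldThetaLarge
import HarnessLib

/-!
# Discharge of `Literature.NumberTheory.LFunctions.Schoenfeld1976_psi` (Schoenfeld 1976, Thm. 10 (6.2))

Topic: `Literature/NumberTheory/LFunctions`. THEOREMS (no new definition, no new fact):
`theorem Schoenfeld1976_psi_holds : Schoenfeld1976_psi`, i.e. **under the Riemann hypothesis,
`|ψ(x) − x| < √x log² x/(8π)` for every real `x ≥ 73.2`** (L. Schoenfeld, *Sharper bounds for the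
Chebyshev functions θ(x) and ψ(x). II*, Math. Comp. 30 (1976), 337–360, Thm. 10, (6.2); the named
fact is vendored in `SchoenfeldExplicit.lean`).

Schoenfeld's proof (pp. 337–339): for `x ≥ e¹⁶` the differenced explicit formula for `∫ψ`
(Rosser–Schoenfeld 1975, Lemma 8 with `m = 1`) with the zeros below a height `D` from tables and
Rosser's `N(T)` above it ((6.6)–(6.12), `a₅ > 0` at `ξ = e¹⁶`); below `e¹⁶` the lower side (6.4) from
(6.3) and Gram's table, the upper side (6.17) from `θ(x) < x` (Rosser–Schoenfeld 1962, Thm. 18) and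
Gram's table. The four ranges here:

* `73 ≤ x < 65538`: the kernel-certified walk over the prime powers
  (`PsiChain.abs_psi_sub_lt_small`, `SchoenfeldPsiTable.lean`; unconditional);
* `16⁴ ≤ x ≤ 55⁴`: the explicit formula with the `169` zeros below `350`
  (`SchoenfeldPsiMid.abs_psi_sub_lt_midRange`, `SchoenfeldPsiMid.lean`);
* `54.598⁴ ≤ x ≤ 160⁴`: the explicit formula with the `2000` zeros below `2516`, reusing the `ψ`-bounds
  `SchoenfeldMid.sub_psi_le_of_RH` / `psi_sub_le_of_RH` and the kernel grid `SchoenfeldMid.grid_bound`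
  of the tree's `θ`-discharge (`SchoenfeldThetaMid.lean`): the grid inequalities (I)/(II) proved there
  for `θ` carry the extra terms `ψ − θ`, which makes the `ψ`-inequalities strict
  (`abs_psi_sub_lt_of_fourthRoot_mid`);
* `x ≥ 160⁴`: zeros summed to the height `√x` through `N(T)` (`SchoenfeldLarge.sub_psi_le_large`,
  `psi_sub_le_large`, `main_part_le`, `junk_upper_le`, `junk_lower_le`, `SchoenfeldThetaLarge.lean`),
  where the margin `(2.9 − 43/25 − C₁)s² ≥ 1.13 s²` of the `θ`-proof gives strictness
  (`abs_psi_sub_lt_of_fourthRoot_large`).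

Computational dependencies (declared `computational` at the gate): the tree's certified first `2000`
zeros of `ζ` (`MertensCertificate`, `native_decide`) and `SchoenfeldBound.lowSums350_check`
(`native_decide`); kernel computations (`decide +kernel`) of `SchoenfeldPsiTable.lean` and the grids.

## References

* L. Schoenfeld, *Sharper bounds for the Chebyshev functions θ(x) and ψ(x). II*, Math. Comp. 30
  (1976), 337–360, Thm. 10 (6.2), (6.4), (6.17), proof pp. 337–339. [Schoenfeld1976]
* J. B. Rosser, L. Schoenfeld, *Sharper bounds for the Chebyshev functions θ(x) and ψ(x)*, Math.
  Comp. 29 (1975), 243–269, Lemmas 8–9. [RosserSchoenfeld1975]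
-/

noncomputable section

open Real
open scoped Chebyshev

namespace Literature.NumberTheory.LFunctions

namespace SchoenfeldPsiAssembly

open SchoenfeldBound NicolasJExplicit SchoenfeldMid SchoenfeldLarge

/-- **`54.598 ≤ s ≤ 160`**: under RH, `|ψ(s⁴) − s⁴| < √(s⁴) log²(s⁴)/(8π)`. The `ψ`-bounds at the fixed
height `2516` (`SchoenfeldMid.sub_psi_le_of_RH`, `psi_sub_le_of_RH`) against the grid inequalities
(I)/(II) of `SchoenfeldMid.grid_bound`, whose left sides exceed the `ψ`-majorants strictly
(`5.68365419 s² + 0.1704830838 s < 6.80264 s² + 1.8379`, `log 2π ≤ 1.8379 < …`).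
[cite: Schoenfeld1976, Thm. 10 (6.2), proof pp. 337–339] -/
theorem abs_psi_sub_lt_of_fourthRoot_mid (hRH : RiemannHypothesis) {s : ℝ} (h1 : 54.598 ≤ s)
    (h2 : s ≤ 160) :
    |ψ (s ^ 4) - s ^ 4| < Real.sqrt (s ^ 4) * Real.log (s ^ 4) ^ 2 / (8 * π) := by
  have hs2 : (2 : ℝ) ≤ s := by linarith
  have hs0 : 0 < s := by linarith
  rw [sqrt_pow_four, Real.log_pow, abs_sub_lt_iff]
  have e : s ^ 2 * ((4 : ℕ) * Real.log s) ^ 2 / (8 * π) = 2 / π * s ^ 2 * Real.log s ^ 2 := by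
    push_cast; field_simp; ring
  rw [e]
  obtain ⟨-, gI, gII⟩ := grid_bound h1 h2
  have hU := SchoenfeldMid.psi_sub_le_of_RH hRH hs2
  have hL := SchoenfeldMid.sub_psi_le_of_RH hRH hs2
  have hl2 := log_two_pi_le
  have hπ := Real.pi_pos
  have hlog : 0 < Real.log s := Real.log_pos (by linarith)
  have hextra : 0 ≤ s * Real.log s ^ 2 / (2 * π) := by positivity
  rcases lt_or_ge s 100 with hs | hs
  · have g := gI hs
    constructor <;> nlinarith [g]
  · have g := gII hs
    constructor <;> nlinarith [g]

/-- **`s ≥ 160`**: under RH, `|ψ(s⁴) − s⁴| < √(s⁴) log²(s⁴)/(8π)`. The `ψ`-bounds with the zeros summed to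
the height `s² = √x` (`SchoenfeldLarge.sub_psi_le_large`, `psi_sub_le_large`), regrouped as
`s²·M + J` (`upper_regroup`, `lower_regroup`) with `s²(M + (2.9 − 43/25 − C₁)) ≤ (2/π) s² log² s`
(`main_part_le`), `J ≤ 0.16 s²` resp. `0.035 s²` (`junk_upper_le`, `junk_lower_le`) and `C₁ ≤ 1/20`:
the margin `(1.18 − C₁)s²` is positive. [cite: Schoenfeld1976, Thm. 10 (6.2), proof pp. 337–339] -/
theorem abs_psi_sub_lt_of_fourthRoot_large (hRH : RiemannHypothesis) {s : ℝ} (hs : 160 ≤ s) :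
    |ψ (s ^ 4) - s ^ 4| < Real.sqrt (s ^ 4) * Real.log (s ^ 4) ^ 2 / (8 * π) := by
  have hs0 : 0 < s := by linarith
  have hπ0 := Real.pi_pos
  have hl1 := log_two_pi_ge
  have hl2 := log_two_pi_le
  have hC := C1_le
  have hlam1 : 5.0751 ≤ Real.log s := (aux_bounds hs).1
  rw [sqrt_pow_four, Real.log_pow, abs_sub_lt_iff]
  have e : s ^ 2 * ((4 : ℕ) * Real.log s) ^ 2 / (8 * π) = s ^ 2 * (2 / π * Real.log s ^ 2) := by
    push_cast; field_simp; ring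
  rw [e]
  have hs2 : (0 : ℝ) < s ^ 2 := by positivity
  have hM := mul_le_mul_of_nonneg_left (main_part_le (C := C1) hlam1 hl1 hl2) hs2.le
  constructor
  · have hU := psi_sub_le_large hRH hs
    rw [upper_regroup hs0] at hU
    have hJ := junk_upper_le hs
    nlinarith [hM, hU, hJ, hC, hs2]
  · have hL := sub_psi_le_large hRH hs
    rw [lower_regroup hs0] at hL
    have hJ := junk_lower_le hs
    nlinarith [hM, hL, hJ, hC, hs2]

/-- From the fourth root back to `x`: under RH, `|ψ(x) − x| < √x log² x/(8π)` for `x ≥ 8886013`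
(`54.598⁴ < 8886013`; the two ranges `s ≤ 160` and `s ≥ 160`). [cite: Schoenfeld1976, Thm. 10 (6.2)] -/
theorem abs_psi_sub_lt_of_ge (hRH : RiemannHypothesis) {x : ℝ} (hx : 8886013 ≤ x) :
    |ψ x - x| < Real.sqrt x * Real.log x ^ 2 / (8 * π) := by
  have hx0 : 0 ≤ x := by linarith
  set s := Real.sqrt (Real.sqrt x) with hsdef
  have hs0 : 0 ≤ s := Real.sqrt_nonneg _
  have hs4 : s ^ 4 = x := by
    rw [show s ^ 4 = (s ^ 2) ^ 2 by ring, hsdef, Real.sq_sqrt (Real.sqrt_nonneg _), Real.sq_sqrt hx0]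
  have hlo : 54.598 ≤ s := by
    by_contra hlt
    rw [not_le] at hlt
    have := pow_lt_pow_left₀ hlt hs0 (by norm_num : (4 : ℕ) ≠ 0)
    rw [hs4] at this
    norm_num at this
    linarith
  rcases le_total s 160 with hle | hle
  · have := abs_psi_sub_lt_of_fourthRoot_mid hRH hlo hle
    rwa [hs4] at this
  · have := abs_psi_sub_lt_of_fourthRoot_large hRH hle
    rwa [hs4] at this

end SchoenfeldPsiAssembly

open SchoenfeldPsiAssembly in
/-- **Schoenfeld 1976, Theorem 10, (6.2) — the named fact `Schoenfeld1976_psi` holds**: under RH,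
`|ψ(x) − x| < √x log² x/(8π)` for all `x ≥ 73.2`. Assembled from `PsiChain.abs_psi_sub_lt_small`
(`[73, 65538)`, kernel-certified prime powers, unconditional), `SchoenfeldPsiMid.abs_psi_sub_lt_midRange`
(`[16⁴, 55⁴]`, zeros below `350`), `abs_psi_sub_lt_of_fourthRoot_mid` (`[54.598⁴, 160⁴]`, zeros below
`2516`) and `abs_psi_sub_lt_of_fourthRoot_large` (`x ≥ 160⁴`, zeros below `√x`). Computational
dependencies: the tree's certified first `2000` zeros of `ζ` and `SchoenfeldBound.lowSums350_check`
(`native_decide`). [cite: Schoenfeld1976, Thm. 10 (6.2)] -/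
theorem Schoenfeld1976_psi_holds : Schoenfeld1976_psi := by
  intro hRH x hx
  rcases lt_or_ge x 65538 with h1 | h1
  · exact PsiChain.abs_psi_sub_lt_small (by norm_num at hx ⊢; linarith) h1
  rcases le_or_gt x 9150625 with h2 | h2
  · exact SchoenfeldPsiMid.abs_psi_sub_lt_midRange hRH (by linarith) h2
  · exact abs_psi_sub_lt_of_ge hRH (by linarith)

end Literature.NumberTheory.LFunctions

end
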